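/-
Copyright (c) 2026 the pub-hodgecm-mathlib formalisation cell (harness21).  Prover seat hodgecm-mathlib-F0P3a-p02 (g27), 2026-09-03.  Road M6 «ROW 2 ★ DYADIC TWIN» → F3
«TOT-Λ BY OVER-ORDERS» (LEAD F0P3a-plan T14-66 ∕ T15-08; WORD #77 queue), carve (c10) of SIG-F3-5 (LH7-p04 (g11)) = the boundary clause (UG-bdry) of SIG-F3-3 §0 (LH4-p01 (g9)).
-/
import Literature.NumberTheory.Automorphic.QuadraticEisensteinOrderNormIndex   -- ★ (L3′) p851869 (B-p04): brings (L1′) `QuadraticEisensteinOrderUnitIndex`, (L2′), ★ `QuadraticRamifiedOrderNormIndex` (frame lemmas `range_norm_eq`, `exists_coord_fixed`, `mem_eqLocus_prodMap_iff`, `prodMap_subtype_injective`, `star_involutive`, `comp_mem_eqLocus`, `map_k₀_mem_maximalIdeal`), ★ `InvolutionDescentUnitIndex`, ★ `UnitIndexModuloConductor`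
import HarnessLib

/-!
# The unit index of the PRODUCT over-order `G₀(N) = 𝒪_E × O_N` (glue depth `b = 0`): `[Λ^× : G₀^×] = q_E^N` and `[C_{G₀} : G₀^×] = q^N`

Topic `NumberTheory/Automorphic`; namespace `Literature.NumberTheory.Automorphic`.  THEOREMS ONLY (no definition, no instance, no notation, no named fact, no
`sorry`); kernel lane `--supports stmt-HodgeConjecture-24833`.  Cell `pub/hodgecm-mathlib` (D-0151), crux H413 = `stmt-HodgeConjecture-24833`; road M6 → F3 «TOT-Λ by
over-orders» (route (B)): SIG-F3-3 §0 (LH4-p01 (g9)) re-cut F3-3 as «every GOOD glued over-order `G(N″, b, ιO y)` with `b ≥ 1` has a deep unitary generator», so that ★ (L3′)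
`relIndex_units_comap_norm_eq_eisenstein` gives `[C_G : G^×] = (q+1)q^{N″+b−1}` BY NAME (★ `GluedOverOrderUnitaryGenerator`, LH4-p01); the BOUNDARY `b = 0` — the product
orders `G₀(N″) = 𝒪_E × O_{N″}`, which are NOT local, so (L3′) does not apply — was left as the separate plane count «(UG-bdry) `[C_G : G^×] = q^{N″}`» (SIG-F3-3 §0, SIG-F3-5
(S6) second clause, carve (c10)).  THIS FILE proves it, in ★ (UG-idx) `exists_generator_relIndex_units_comap_norm_glued_eq`'s letters token for token: `Λ = 𝒪[E] × O₁`
(`O₁ = j𝒪_E ⊕ j𝒪_E θ`, `θ² = j(ιO a)θ + j(ιO k₀)`, `a, k₀ ∈ 𝔪_F` — Eisenstein with `F`-rational coefficients; involution `⋆ = RingHom.prodMap σO σ₁`, `σ₁` over `σO` fixing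
`θ`), `S^× := (Units.map S.subtype).range ≤ Λ^×` for a subring `S`, the norm `Nm := MonoidHom.id Λˣ * Units.map ⋆` (`c ↦ c·c⋆`), `C_S := S^×.comap Nm` and
`[C_S : S^×] := S^×.relIndex C_S`.  The product order enters as ANY subring `S` with
`(S : Set Λ) = {z | ∃ b₀ c₀, z.2 = j b₀ + j c₀ · Π_N}`, `Π_N := j(ϖ^N)·θ` — ★ F3-1a's glued set `G(N, 0, c′)` (`GluedOverOrders.exists_subring_coe_eq_glued N 0 c′`), whose
glue conjunct `z.1 − (b₀ + c₀c′) ∈ (ϖ^0) = ⊤` is vacuous (§0 `setOf_glued_zero_eq`).  Binder lists ⊆ (UG-idx)'s: NO unit different `hξ`, NO `hnormEb`, NO level datum, any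
`N : ℕ` (incl. `0`); no `2`, no `IsUnit 2`, no `d`, no parity binder (T14-66 KILL clause honoured).
HONEST LABEL: HC_CM is proved only modulo the 7 printed citations (2 remaining named inputs: hLiu418 = stmt-HodgeConjecture-24832, h413 = stmt-HodgeConjecture-24833) until
rung 0 closes; elementary commutative algebra, count-neutral (pays no organ, opens no road; zero label movement until F5 ★ and a desk-priced rider).

THE MATHEMATICS.  (§1, one valued field `F`, `O₁ = j𝒪 ⊕ j𝒪θ` Eisenstein, `G₀ = G₀(N) = 𝒪 × O_N ≤ Λ = 𝒪 × O₁`, `N ≥ 1`.)  The conductor ideal `𝔣 = ϖ^N Λ` lies in `G₀` and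
in `rad Λ` (★ `prod_span_le_jacobson_eisenstein`), so the dévissage ★ `index_range_units_map_mul_natCard_units_quotient` reads `[Λ^× : G₀^×] · #(G₀ ⧸ 𝔣)^× = #(Λ ⧸ 𝔣)^×`;
`#(Λ ⧸ 𝔣)^× = q^{N−1}(q−1) · q^{2N−1}(q−1)` (★ `natCard_units_quotient_prod_span_eisenstein`) and `G₀ ⧸ 𝔣 ≅ (𝒪 ⧸ ϖ^N) × (𝒪 ⧸ ϖ^N)` through
`(y, j b₀ + j c₀ Π_N) ↦ (ȳ, b̄₀)` — a RING map because `Π_N² = ϖ^N a Π_N + ϖ^{2N} k ∈ ϖ^N O_N` — so `#(G₀ ⧸ 𝔣)^× = (q^{N−1}(q−1))²` (★ `natCard_units_quotient_span_uniformizer_pow`)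
and **`[Λ^× : G₀^×] = q^N`** (= `[O₁^× : O_N^×] = #(O₁⧸ϖ^N O₁)^× ∕ #(𝒪⧸ϖ^N)^×`, Neukirch I §12); `N = 0`: `G₀ = Λ`, index `1`.  (§2, two fields `ιO : 𝒪_F → 𝒪_E`, fixed side.)
Along `Ψ₀ = (ιO, incl) : 𝒪_F × O₁^{σ₁} → Λ` (range `Λ^⋆`) the product order pulls back to the product order `𝒪_F × O_N^{σ₁}` of the FIXED model, which is again Eisenstein over
`𝒪_F` (★ `exists_coord_fixed`; the `θ`-coordinate of a fixed element of `O_N` descends to `ϖ_F^N 𝒪_F` because `σO ϖ = ϖ`), so §1 over `F` and `Subgroup.index_comap` along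
`Units.map Ψ₀` give **`[(Λ^⋆)^× : G₀^× ∩ (Λ^⋆)^×] = q_F^N`** (the ★ (L3′) `relIndex_units_fixed_eq_eisenstein` pattern).  (§3.) `G₀⋆ = G₀` (`σ₁ Π_N = Π_N`), the norm is onto
the fixed units (★ `range_norm_eq`), and ★ `relIndex_comap_norm_mul_relIndex_eq_index` reads `[C_{G₀} : G₀^×] · q_F^N = [Λ^× : G₀^×] = q_E^N = q_F^{2N}`, whence
**`[C_{G₀} : G₀^×] = q_F^N`** — Rogawski's `q^N` plane count at the product orders, for ALL rows (tame and wild alike: only `θ² = jaθ + jk` Eisenstein is used).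

* §0 `setOf_glued_zero_eq`; §1 `exists_coord_prodOrder`, `natCard_units_quotient_prodOrder`, **`index_units_prodOrder_eq_pow`**; §2 `coe_comap_prodOrder_eq`,
  **`relIndex_units_fixed_prodOrder_eq_pow`**; §3 **`relIndex_units_comap_norm_prodOrder_eq_pow`** (the (UG-bdry) head).

## References
* [Rogawski1990] J. D. Rogawski, *Automorphic Representations of Unitary Groups in Three Variables*, Ann. of Math. Stud. 123 (1990): §4.9 Lemma 4.9.3 p. 56, Prop. 4.9.1 (b) p. 55.
* [Neukirch1999] J. Neukirch, *Algebraic Number Theory*, Grundlehren 322 (1999): Ch. I §12 (orders, conductor, `[𝒪_K^× : 𝒪^×] = #(𝒪_K⧸𝔣)^× ∕ #(𝒪⧸𝔣)^×`).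
* [SerreLocalFields1979] J.-P. Serre, *Local Fields*, GTM 67 (1979): Ch. I §6 Prop. 17–18 (Eisenstein bases); Ch. V §2 Prop. 3 and Corollary (unit norms, unramified case).
* [Jacobowitz1962] R. Jacobowitz, *Hermitian forms over local fields*, Amer. J. Math. 84 (1962): §7 (lattices of an order as a units-torsor).
-/

set_option autoImplicit false

noncomputable section

open scoped ValuativeRel
open Polynomial ValuativeRel

namespace Literature.NumberTheory.Automorphic

open Literature.RingTheory.GaloisAlgebras Literature.RingTheory.JacobsonRadical

/-! ## §0 The glued set at depth `b = 0` is the product-order set -/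

section Bridge

variable {E : Type*} [Field E] [ValuativeRel E] {O₁ : Type*} [CommRing O₁] (j : 𝒪[E] →+* O₁) (θ : O₁) (ϖO : 𝒪[E])

/-- ★ F3-1a's glued set `G(N, b, c′)` at glue depth `b = 0` is the PRODUCT-ORDER set `{(y, j b₀ + j c₀ Π_N)}` (the congruence modulo `ϖ^0 = 1` is vacuous).
[cite: Neukirch1999, Ch. I §12] -/
theorem setOf_glued_zero_eq (N : ℕ) (c' : 𝒪[E]) :
    {z : 𝒪[E] × O₁ | ∃ b₀ c₀ : 𝒪[E], z.2 = j b₀ + j c₀ * (j (ϖO ^ N) * θ) ∧ z.1 - (b₀ + c₀ * c') ∈ Ideal.span {ϖO ^ 0}} =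
      {z : 𝒪[E] × O₁ | ∃ b₀ c₀ : 𝒪[E], z.2 = j b₀ + j c₀ * (j (ϖO ^ N) * θ)} := by
  ext z
  simp only [Set.mem_setOf_eq, pow_zero, Ideal.span_singleton_one, Submodule.mem_top, and_true]

end Bridge

/-! ## §1 One valued field: `[Λ^× : G₀(N)^×] = q^N` for `Λ = 𝒪 × O₁`, `G₀(N) = 𝒪 × O_N` -/

section OneField

variable {F : Type*} [Field F] [ValuativeRel F] {O₁ : Type*} [CommRing O₁] (j : 𝒪[F] →+* O₁) (θ : O₁) {a k : 𝒪[F]}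

/-- Coordinates on the product order: every `z ∈ G₀(N)` has `z.2 = j b₀ + j c₀ Π_N`, and the `j`-coordinate `b₀` is UNIQUE (`Π_N = j(ϖ^N)θ`, ★ `coord_unique`).
[cite: SerreLocalFields1979, Ch. I §6 Prop. 18] -/
theorem exists_coord_prodOrder (hcoord : ∀ z : O₁, ∃! bc : 𝒪[F] × 𝒪[F], z = j bc.1 + j bc.2 * θ) (ϖO : 𝒪[F]) (N : ℕ)
    {b₀ c₀ b₀' c₀' : 𝒪[F]} (h : j b₀ + j c₀ * (j (ϖO ^ N) * θ) = j b₀' + j c₀' * (j (ϖO ^ N) * θ)) :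
    b₀ = b₀' ∧ c₀ * ϖO ^ N = c₀' * ϖO ^ N := by
  have hre : ∀ b c : 𝒪[F], j b + j c * (j (ϖO ^ N) * θ) = j b + j (c * ϖO ^ N) * θ := fun b c => by rw [map_mul]; ring
  rw [hre, hre] at h
  exact coord_unique j θ hcoord h

/-- **`#(G₀(N) ⧸ ϖ^N Λ)^× = (q^{N−1}(q − 1))²`** for `N ≥ 1`: the map `(y, j b₀ + j c₀ Π_N) ↦ (ȳ, b̄₀) : G₀(N) → (𝒪⧸ϖ^N) × (𝒪⧸ϖ^N)` is a surjective RING homomorphism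
(`Π_N² = ϖ^N a·Π_N + ϖ^{2N} k`, so the `j`-coordinate is multiplicative modulo `ϖ^N`) with kernel `ϖ^N Λ ∩ G₀(N)`; then ★ `natCard_units_quotient_span_uniformizer_pow` on each
factor. [cite: Neukirch1999, Ch. I §12] [cite: SerreLocalFields1979, Ch. I §6 Prop. 17–18] -/
theorem natCard_units_quotient_prodOrder [Finite 𝓀[F]] (hθ : θ ^ 2 = j a * θ + j k)
    (hcoord : ∀ z : O₁, ∃! bc : 𝒪[F] × 𝒪[F], z = j bc.1 + j bc.2 * θ) {ϖ : F} (hϖ : IsUniformizingElement ϖ) {N : ℕ} (hN : 0 < N)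
    (S : Subring (𝒪[F] × O₁))
    (hS : (S : Set (𝒪[F] × O₁)) = {z : 𝒪[F] × O₁ | ∃ b₀ c₀ : 𝒪[F], z.2 = j b₀ + j c₀ * (j ((⟨ϖ, hϖ.mem⟩ : 𝒪[F]) ^ N) * θ)}) :
    Nat.card (S ⧸ Ideal.comap S.subtype
      (Ideal.span ({(((⟨ϖ, hϖ.mem⟩ : 𝒪[F]) ^ N, j ((⟨ϖ, hϖ.mem⟩ : 𝒪[F]) ^ N)) : 𝒪[F] × O₁)} : Set (𝒪[F] × O₁))))ˣ =
      (Nat.card 𝓀[F] ^ (N - 1) * (Nat.card 𝓀[F] - 1)) ^ 2 := by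
  classical
  set π : 𝒪[F] := ⟨ϖ, hϖ.mem⟩ with hπ
  set P : O₁ := j (π ^ N) * θ with hP
  set I : Ideal 𝒪[F] := Ideal.span ({π ^ N} : Set 𝒪[F]) with hI
  set 𝔣 : Ideal (𝒪[F] × O₁) := Ideal.span ({((π ^ N, j (π ^ N)) : 𝒪[F] × O₁)} : Set (𝒪[F] × O₁)) with h𝔣
  have hθ' : θ * θ = j a * θ + j k := by rw [← sq]; exact hθ
  have hP2 : P * P = j (π ^ N * a) * P + j (π ^ (2 * N) * k) := by
    have h : P * P = j (π ^ N) * j (π ^ N) * (θ * θ) := by rw [hP]; ring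
    rw [h, hθ']
    simp only [hP, map_mul, map_pow]
    ring
  -- coordinates of the elements of `S`
  have hmem : ∀ z : S, ∃ b₀ c₀ : 𝒪[F], ((z : 𝒪[F] × O₁)).2 = j b₀ + j c₀ * P := fun z => by
    have hz : (z : 𝒪[F] × O₁) ∈ (S : Set (𝒪[F] × O₁)) := z.2
    rwa [hS] at hz
  choose β γ hβγ using hmem
  have huniq : ∀ (z : S) (b₀ c₀ : 𝒪[F]), ((z : 𝒪[F] × O₁)).2 = j b₀ + j c₀ * P → β z = b₀ := fun z b₀ c₀ h =>
    (exists_coord_prodOrder j θ hcoord π N ((hβγ z).symm.trans h)).1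
  have hmemS : ∀ {z : 𝒪[F] × O₁} (b₀ c₀ : 𝒪[F]), z.2 = j b₀ + j c₀ * P → z ∈ S := fun b₀ c₀ h => by
    rw [← SetLike.mem_coe, hS]; exact ⟨b₀, c₀, h⟩
  -- the ring map `ψ : S → (𝒪⧸ϖ^N) × (𝒪⧸ϖ^N)`, `(y, j b₀ + j c₀ Π_N) ↦ (ȳ, b̄₀)`
  have hβ1 : β 1 = 1 := huniq 1 1 0 (by simp)
  have hβ0 : β 0 = 0 := huniq 0 0 0 (by simp)
  have hβadd : ∀ z z' : S, β (z + z') = β z + β z' := fun z z' =>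
    huniq (z + z') (β z + β z') (γ z + γ z') (by
      rw [Subring.coe_add, Prod.snd_add, hβγ z, hβγ z', map_add, map_add]; ring)
  have hβmul : ∀ z z' : S, β (z * z') = β z * β z' + γ z * γ z' * (π ^ (2 * N) * k) := fun z z' =>
    huniq (z * z') _ (β z * γ z' + γ z * β z' + γ z * γ z' * (π ^ N * a)) (by
      rw [Subring.coe_mul, Prod.snd_mul, hβγ z, hβγ z']
      have : (j (β z) + j (γ z) * P) * (j (β z') + j (γ z') * P) =
          j (β z) * j (β z') + (j (β z) * j (γ z') + j (γ z) * j (β z')) * P + j (γ z) * j (γ z') * (P * P) := by ring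
      rw [this, hP2]
      simp only [map_add, map_mul]
      ring)
  set ψ : S →+* (𝒪[F] ⧸ I) × (𝒪[F] ⧸ I) :=
    { toFun := fun z => (Ideal.Quotient.mk I ((z : 𝒪[F] × O₁)).1, Ideal.Quotient.mk I (β z))
      map_one' := Prod.ext (by simp) (by change Ideal.Quotient.mk I (β 1) = 1; rw [hβ1, map_one])
      map_mul' := fun z z' => Prod.ext (by simp) (by
        change Ideal.Quotient.mk I (β (z * z')) = Ideal.Quotient.mk I (β z) * Ideal.Quotient.mk I (β z')
        rw [hβmul, ← map_mul, Ideal.Quotient.eq, hI, Ideal.mem_span_singleton']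
        exact ⟨γ z * γ z' * π ^ N * k, by ring⟩)
      map_zero' := Prod.ext (by simp) (by change Ideal.Quotient.mk I (β 0) = 0; rw [hβ0, map_zero])
      map_add' := fun z z' => Prod.ext (by simp) (by
        change Ideal.Quotient.mk I (β (z + z')) = Ideal.Quotient.mk I (β z) + Ideal.Quotient.mk I (β z')
        rw [hβadd, map_add]) } with hψ
  have hψapp : ∀ z : S, ψ z = (Ideal.Quotient.mk I ((z : 𝒪[F] × O₁)).1, Ideal.Quotient.mk I (β z)) := fun _ => rfl
  have hsurj : Function.Surjective ψ := by
    rintro ⟨x, y⟩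
    obtain ⟨x', rfl⟩ := Ideal.Quotient.mk_surjective x
    obtain ⟨y', rfl⟩ := Ideal.Quotient.mk_surjective y
    have hzS : ((x', j y') : 𝒪[F] × O₁) ∈ S := hmemS y' 0 (by simp)
    refine ⟨⟨(x', j y'), hzS⟩, ?_⟩
    rw [hψapp, huniq ⟨(x', j y'), hzS⟩ y' 0 (by simp)]
  have hker : RingHom.ker ψ = Ideal.comap S.subtype 𝔣 := by
    ext z
    rw [RingHom.mem_ker, hψapp, Prod.mk_eq_zero, Ideal.Quotient.eq_zero_iff_mem, Ideal.Quotient.eq_zero_iff_mem, Ideal.mem_comap,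
      Subring.coe_subtype, h𝔣, Ideal.mem_span_singleton', hI, Ideal.mem_span_singleton', Ideal.mem_span_singleton']
    constructor
    · rintro ⟨⟨x, hx⟩, ⟨b₁, hb₁⟩⟩
      refine ⟨(x, j b₁ + j (γ z) * θ), Prod.ext ?_ ?_⟩
      · rw [Prod.fst_mul, hx]
      · rw [Prod.snd_mul, hβγ z, ← hb₁]
        simp only [map_mul, hP]
        ring
    · rintro ⟨⟨x, w⟩, hxw⟩
      obtain ⟨⟨b, c⟩, hw, -⟩ := hcoord w
      have h1 : ((z : 𝒪[F] × O₁)).1 = x * π ^ N := by rw [← hxw, Prod.fst_mul]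
      have h2 : ((z : 𝒪[F] × O₁)).2 = j (b * π ^ N) + j c * P := by
        rw [← hxw, Prod.snd_mul, hw]
        simp only [map_mul, hP]
        ring
      exact ⟨⟨x, h1.symm⟩, ⟨b, by rw [huniq z _ _ h2, mul_comm]⟩⟩
  have e : (S ⧸ Ideal.comap S.subtype 𝔣) ≃+* (𝒪[F] ⧸ I) × (𝒪[F] ⧸ I) :=
    (Ideal.quotEquivOfEq hker.symm).trans (RingHom.quotientKerEquivOfSurjective hsurj)
  rw [Nat.card_congr (Units.mapEquiv e.toMulEquiv).toEquiv, Nat.card_congr (MulEquiv.prodUnits).toEquiv, Nat.card_prod,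
    natCard_units_quotient_span_uniformizer_pow hϖ hN, sq]

/-- **`[Λ^× : G₀(N)^×] = q^N`** for the product over-order `G₀(N) = 𝒪 × O_N ≤ Λ = 𝒪 × O₁` (`O₁` Eisenstein: `θ² = jaθ + jk`, `a, k ∈ 𝔪`), `G₀(N)^×` read as
`(Units.map S.subtype).range`: for `N ≥ 1` the dévissage ★ `index_range_units_map_mul_natCard_units_quotient` through `𝔣 = ϖ^N Λ ⊆ G₀(N)` (`𝔣 ⊆ rad Λ`, ★
`prod_span_le_jacobson_eisenstein`) with `#(Λ⧸𝔣)^× = q^{N−1}(q−1)·q^{2N−1}(q−1)` (★ `natCard_units_quotient_prod_span_eisenstein`) and `#(G₀⧸𝔣)^× = (q^{N−1}(q−1))²`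
(`natCard_units_quotient_prodOrder`); for `N = 0`, `G₀(0) = Λ`.  (= `[O₁^× : O_N^×]`, the conductor-`N` unit index of the ramified quadratic order.)
[cite: Neukirch1999, Ch. I §12] [cite: SerreLocalFields1979, Ch. I §6 Prop. 17–18] -/
theorem index_units_prodOrder_eq_pow [Finite 𝓀[F]] (hθ : θ ^ 2 = j a * θ + j k) (ha : a ∈ IsLocalRing.maximalIdeal 𝒪[F])
    (hk : k ∈ IsLocalRing.maximalIdeal 𝒪[F]) (hcoord : ∀ z : O₁, ∃! bc : 𝒪[F] × 𝒪[F], z = j bc.1 + j bc.2 * θ)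
    {ϖ : F} (hϖ : IsUniformizingElement ϖ) (N : ℕ) (S : Subring (𝒪[F] × O₁))
    (hS : (S : Set (𝒪[F] × O₁)) = {z : 𝒪[F] × O₁ | ∃ b₀ c₀ : 𝒪[F], z.2 = j b₀ + j c₀ * (j ((⟨ϖ, hϖ.mem⟩ : 𝒪[F]) ^ N) * θ)}) :
    (Units.map (S.subtype : S →* 𝒪[F] × O₁)).range.index = Nat.card 𝓀[F] ^ N := by
  classical
  set π : 𝒪[F] := ⟨ϖ, hϖ.mem⟩ with hπ
  have hmemS : ∀ {z : 𝒪[F] × O₁} (b₀ c₀ : 𝒪[F]), z.2 = j b₀ + j c₀ * (j (π ^ N) * θ) → z ∈ S := fun b₀ c₀ h => by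
    rw [← SetLike.mem_coe, hS]; exact ⟨b₀, c₀, h⟩
  rcases Nat.eq_zero_or_pos N with rfl | hN
  · -- `G₀(0) = Λ`
    have htop : (Units.map (S.subtype : S →* 𝒪[F] × O₁)).range = ⊤ := by
      refine top_unique fun w _ => ?_
      have hall : ∀ z : 𝒪[F] × O₁, z ∈ S := fun z => by
        obtain ⟨⟨b, c⟩, hz, -⟩ := hcoord z.2
        exact hmemS b c (by rw [hz, pow_zero, map_one, one_mul])
      rw [mem_range_units_map_subtype_iff]
      exact ⟨hall _, hall _⟩
    rw [htop, Subgroup.index_top, pow_zero]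
  · set 𝔣 : Ideal (𝒪[F] × O₁) := Ideal.span ({((π ^ N, j (π ^ N)) : 𝒪[F] × O₁)} : Set (𝒪[F] × O₁)) with h𝔣
    have hq : 1 < Nat.card 𝓀[F] := Finite.one_lt_card
    have h𝔣S : (𝔣 : Set (𝒪[F] × O₁)) ⊆ S := by
      intro z hz
      rw [SetLike.mem_coe, h𝔣, Ideal.mem_span_singleton'] at hz
      obtain ⟨⟨x, w⟩, rfl⟩ := hz
      obtain ⟨⟨b, c⟩, hw, -⟩ := hcoord w
      refine hmemS (b * π ^ N) c ?_
      rw [Prod.snd_mul, hw]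
      simp only [map_mul]
      ring
    have h𝔣J : 𝔣 ≤ Ideal.jacobson ⊥ := prod_span_le_jacobson_eisenstein j θ hθ ha hk hcoord hϖ hN
    have key := index_range_units_map_mul_natCard_units_quotient S 𝔣 h𝔣S h𝔣J
    rw [natCard_units_quotient_prodOrder j θ hθ hcoord hϖ hN S hS, natCard_units_quotient_prod_span_eisenstein j θ hθ ha hk hcoord hϖ hN] at key
    -- arithmetic: `X · (q^{N−1}(q−1))² = q^{N−1}(q−1) · q^{2N−1}(q−1)` ⇒ `X = q^N`
    obtain ⟨N', rfl⟩ := Nat.exists_eq_add_of_le hN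
    obtain ⟨p, hp⟩ : ∃ p, Nat.card 𝓀[F] = p + 1 := ⟨Nat.card 𝓀[F] - 1, by omega⟩
    set X := (Units.map (S.subtype : S →* 𝒪[F] × O₁)).range.index
    rw [hp] at key ⊢
    simp only [Nat.add_sub_cancel, Nat.add_sub_cancel_left] at key
    have e1 : 2 * (1 + N') - 1 = 2 * N' + 1 := by omega
    rw [e1] at key
    have hp0 : 0 < p := by omega
    have hpos : 0 < ((p + 1) ^ N' * p) ^ 2 := pow_pos (Nat.mul_pos (pow_pos (Nat.succ_pos p) _) hp0) 2
    refine Nat.eq_of_mul_eq_mul_right hpos ?_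
    rw [key]
    ring

end OneField

/-! ## §2 Two fields: the fixed side `[(Λ^⋆)^× : G₀(N)^× ∩ (Λ^⋆)^×] = q_F^N` -/

section TwoFields

variable {F E : Type*} [Field F] [ValuativeRel F] [Field E] [ValuativeRel E] {O₁ : Type*} [CommRing O₁]
  (ιO : 𝒪[F] →+* 𝒪[E]) (σO : 𝒪[E] →+* 𝒪[E]) (j : 𝒪[E] →+* O₁) (σ₁ : O₁ →+* O₁) (θ : O₁) {aF k₀F : 𝒪[F]}

/-- **THE PRODUCT ORDER PULLS BACK TO THE PRODUCT ORDER OF THE FIXED MODEL**: along `Ψ₀ = (ιO, incl) : 𝒪_F × O₁^{σ₁} → 𝒪_E × O₁`,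
`Ψ₀⁻¹(𝒪_E × O_N) = 𝒪_F × O_N^{σ₁}` with `O_N^{σ₁} = j′𝒪_F ⊕ j′𝒪_F·Π_N` (`j′ = j ∘ ιO`, `Π_N = j′(ϖ_F^N)θ` as `ιO ϖ_F = ϖ`): a `σ₁`-fixed `j b₀ + j c₀ Π_N` has `σO`-fixed
coordinates `b₀`, `c₀ ϖ^N` (★ `coord_unique`), and `c₀` itself is fixed since `σO ϖ = ϖ` and `𝒪_E` has no zero-divisors. [cite: SerreLocalFields1979, Ch. V §2]
[cite: Neukirch1999, Ch. I §12] -/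
theorem coe_comap_prodOrder_eq (hσι : ∀ y, σO (ιO y) = ιO y) (hfixO : ∀ x, σO x = x → ∃ y, ιO y = x)
    (hσ₁j : ∀ x, σ₁ (j x) = j (σO x)) (hσ₁θ : σ₁ θ = θ) (hcoord : ∀ z : O₁, ∃! bc : 𝒪[E] × 𝒪[E], z = j bc.1 + j bc.2 * θ)
    {ϖF : F} {ϖ : E} (hϖF : IsUniformizingElement ϖF) (hϖ : IsUniformizingElement ϖ) (hιϖ : ιO ⟨ϖF, hϖF.mem⟩ = ⟨ϖ, hϖ.mem⟩)
    (hj' : ∀ y : 𝒪[F], (j.comp ιO) y ∈ RingHom.eqLocus σ₁ (RingHom.id O₁)) (hθ' : θ ∈ RingHom.eqLocus σ₁ (RingHom.id O₁))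
    (N : ℕ) (S : Subring (𝒪[E] × O₁))
    (hS : (S : Set (𝒪[E] × O₁)) = {z : 𝒪[E] × O₁ | ∃ b₀ c₀ : 𝒪[E], z.2 = j b₀ + j c₀ * (j ((⟨ϖ, hϖ.mem⟩ : 𝒪[E]) ^ N) * θ)}) :
    ((S.comap (RingHom.prodMap ιO (RingHom.eqLocus σ₁ (RingHom.id O₁)).subtype) :
        Subring (𝒪[F] × RingHom.eqLocus σ₁ (RingHom.id O₁))) : Set (𝒪[F] × RingHom.eqLocus σ₁ (RingHom.id O₁))) =
      {z : 𝒪[F] × RingHom.eqLocus σ₁ (RingHom.id O₁) | ∃ b₀ c₀ : 𝒪[F],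
        z.2 = ((j.comp ιO).codRestrict (RingHom.eqLocus σ₁ (RingHom.id O₁)) hj') b₀ +
          ((j.comp ιO).codRestrict (RingHom.eqLocus σ₁ (RingHom.id O₁)) hj') c₀ *
            (((j.comp ιO).codRestrict (RingHom.eqLocus σ₁ (RingHom.id O₁)) hj') ((⟨ϖF, hϖF.mem⟩ : 𝒪[F]) ^ N) * ⟨θ, hθ'⟩)} := by
  set πF : 𝒪[F] := ⟨ϖF, hϖF.mem⟩ with hπF
  set π : 𝒪[E] := ⟨ϖ, hϖ.mem⟩ with hπ
  set Ψ₀ := RingHom.prodMap ιO (RingHom.eqLocus σ₁ (RingHom.id O₁)).subtype with hΨ₀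
  set j' := (j.comp ιO).codRestrict (RingHom.eqLocus σ₁ (RingHom.id O₁)) hj' with hj'def
  have hιπ : ιO (πF ^ N) = π ^ N := by rw [map_pow, hιϖ]
  have hσπ : σO (π ^ N) = π ^ N := by rw [← hιπ, hσι]
  have hπ0 : π ^ N ≠ 0 := pow_ne_zero N hϖ.coe_ne_zero
  ext z
  rw [SetLike.mem_coe, Subring.mem_comap, ← SetLike.mem_coe, hS, Set.mem_setOf_eq, Set.mem_setOf_eq]
  have hΨ2 : (Ψ₀ z).2 = ((z.2 : RingHom.eqLocus σ₁ (RingHom.id O₁)) : O₁) := rfl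
  constructor
  · rintro ⟨b, c, hbc⟩
    rw [hΨ2] at hbc
    -- `σ₁`-fixedness of `z.2` descends the coordinates
    have hfix : σ₁ ((z.2 : RingHom.eqLocus σ₁ (RingHom.id O₁)) : O₁) = (z.2 : O₁) := z.2.2
    have hre : ∀ b c : 𝒪[E], j b + j c * (j (π ^ N) * θ) = j b + j (c * π ^ N) * θ := fun b c => by rw [map_mul]; ring
    have hz2 : ((z.2 : RingHom.eqLocus σ₁ (RingHom.id O₁)) : O₁) = j b + j (c * π ^ N) * θ := by rw [hbc, hre]
    have hfix' : j (σO b) + j (σO c * π ^ N) * θ = j b + j (c * π ^ N) * θ := by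
      have h := hfix
      rw [hz2, map_add, map_mul σ₁, hσ₁j, hσ₁j, hσ₁θ, map_mul σO, hσπ] at h
      exact h
    obtain ⟨hb, hc⟩ := coord_unique j θ hcoord hfix'
    have hc' : σO c = c := mul_right_cancel₀ hπ0 hc
    obtain ⟨b₀, rfl⟩ := hfixO b hb
    obtain ⟨c₀, rfl⟩ := hfixO c hc'
    refine ⟨b₀, c₀, Subtype.ext ?_⟩
    change ((z.2 : RingHom.eqLocus σ₁ (RingHom.id O₁)) : O₁) = j (ιO b₀) + j (ιO c₀) * (j (ιO (πF ^ N)) * θ)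
    rw [hιπ]
    exact hbc
  · rintro ⟨b₀, c₀, hbc⟩
    refine ⟨ιO b₀, ιO c₀, ?_⟩
    rw [hΨ2, hbc]
    change j (ιO b₀) + j (ιO c₀) * (j (ιO (πF ^ N)) * θ) = _
    rw [hιπ]

/-- **`[(Λ^⋆)^× : G₀(N)^× ∩ (Λ^⋆)^×] = q_F^N` INSIDE `Λ^×`** (`Λ^⋆` = the `⋆`-fixed subring, `⋆ = (σO, σ₁)`): the fixed units are the image of the units of the fixed-side model
`𝒪_F × O₁^{σ₁}` under `Units.map Ψ₀` (range `(Λ^⋆)^×`), `G₀(N)^×` pulls back to the units of the fixed model's product order (`coe_comap_prodOrder_eq`), which is again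
Eisenstein over `𝒪_F` (★ `exists_coord_fixed`), so §1 `index_units_prodOrder_eq_pow` over `F` and Mathlib `Subgroup.index_comap` give the count (the ★ (L3′)
`relIndex_units_fixed_eq_eisenstein` pattern). [cite: Neukirch1999, Ch. I §12] [cite: SerreLocalFields1979, Ch. V §2 Prop. 3] -/
theorem relIndex_units_fixed_prodOrder_eq_pow [Finite 𝓀[F]] (hσι : ∀ y, σO (ιO y) = ιO y)
    (hfixO : ∀ x, σO x = x → ∃ y, ιO y = x) (hιinj : Function.Injective ιO)
    (hσ₁j : ∀ x, σ₁ (j x) = j (σO x)) (hσ₁θ : σ₁ θ = θ)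
    (hθ : θ ^ 2 = j (ιO aF) * θ + j (ιO k₀F)) (haF : aF ∈ IsLocalRing.maximalIdeal 𝒪[F]) (hk₀ : k₀F ∈ IsLocalRing.maximalIdeal 𝒪[F])
    (hcoord : ∀ z : O₁, ∃! bc : 𝒪[E] × 𝒪[E], z = j bc.1 + j bc.2 * θ)
    {ϖF : F} {ϖ : E} (hϖF : IsUniformizingElement ϖF) (hϖ : IsUniformizingElement ϖ) (hιϖ : ιO ⟨ϖF, hϖF.mem⟩ = ⟨ϖ, hϖ.mem⟩)
    (N : ℕ) (S : Subring (𝒪[E] × O₁))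
    (hS : (S : Set (𝒪[E] × O₁)) = {z : 𝒪[E] × O₁ | ∃ b₀ c₀ : 𝒪[E], z.2 = j b₀ + j c₀ * (j ((⟨ϖ, hϖ.mem⟩ : 𝒪[E]) ^ N) * θ)}) :
    (Units.map (S.subtype : S →* 𝒪[E] × O₁)).range.relIndex
      (RingHom.eqLocus (RingHom.prodMap σO σ₁) (RingHom.id (𝒪[E] × O₁))).toSubmonoid.units = Nat.card 𝓀[F] ^ N := by
  set Ψ₀ := RingHom.prodMap ιO (RingHom.eqLocus σ₁ (RingHom.id O₁)).subtype with hΨ₀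
  set S₀ := S.comap Ψ₀ with hS₀
  set B₀ := RingHom.eqLocus (RingHom.prodMap σO σ₁) (RingHom.id (𝒪[E] × O₁)) with hB₀
  set V := (Units.map (S.subtype : S →* 𝒪[E] × O₁)).range with hV
  set Φ₀ : (𝒪[F] × RingHom.eqLocus σ₁ (RingHom.id O₁))ˣ →* (𝒪[E] × O₁)ˣ := Units.map (Ψ₀ : _ →* 𝒪[E] × O₁) with hΦ₀
  have hinj := prodMap_subtype_injective ιO σ₁ hιinj
  -- `range Φ₀ = (Λ^⋆)^×`
  have hrange : Φ₀.range = B₀.toSubmonoid.units := by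
    ext w
    rw [Submonoid.mem_units_iff, MonoidHom.mem_range]
    constructor
    · rintro ⟨w₀, rfl⟩
      refine ⟨(mem_eqLocus_prodMap_iff ιO σO σ₁ hσι hfixO _).2 ⟨(w₀ : 𝒪[F] × _), rfl⟩,
        (mem_eqLocus_prodMap_iff ιO σO σ₁ hσι hfixO _).2 ⟨(↑w₀⁻¹ : 𝒪[F] × _), ?_⟩⟩
      rw [hΦ₀, Units.coe_map_inv]; rfl
    · rintro ⟨h1, h2⟩
      obtain ⟨p₁, hp₁⟩ := (mem_eqLocus_prodMap_iff ιO σO σ₁ hσι hfixO _).1 h1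
      obtain ⟨p', hp'⟩ := (mem_eqLocus_prodMap_iff ιO σO σ₁ hσι hfixO _).1 h2
      have hpp : p₁ * p' = 1 := hinj (by rw [map_mul, map_one]; change Ψ₀ p₁ * Ψ₀ p' = 1; rw [hp₁, hp', Units.mul_inv])
      have hp'p : p' * p₁ = 1 := by rw [mul_comm]; exact hpp
      exact ⟨⟨p₁, p', hpp, hp'p⟩, Units.ext hp₁⟩
  -- `G₀^×` pulls back to the units of the fixed model's product order
  have hcomap : V.comap Φ₀ = (Units.map (S₀.subtype : S₀ →* 𝒪[F] × RingHom.eqLocus σ₁ (RingHom.id O₁))).range := by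
    ext w₀
    rw [Subgroup.mem_comap, hV, mem_range_units_map_subtype_iff, mem_range_units_map_subtype_iff, hΦ₀, Units.coe_map, Units.coe_map_inv]
    rfl
  have hidx := Subgroup.index_comap V Φ₀
  -- the fixed model is Eisenstein over `𝒪_F`
  obtain ⟨hj', hθ'⟩ := comp_mem_eqLocus ιO σO j σ₁ θ hσι hσ₁j hσ₁θ
  have hθ'' : (⟨θ, hθ'⟩ : RingHom.eqLocus σ₁ (RingHom.id O₁)) ^ 2 =
      ((j.comp ιO).codRestrict (RingHom.eqLocus σ₁ (RingHom.id O₁)) hj') aF * ⟨θ, hθ'⟩ + ((j.comp ιO).codRestrict (RingHom.eqLocus σ₁ (RingHom.id O₁)) hj') k₀F :=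
    Subtype.ext hθ
  have hcoord' := exists_coord_fixed ιO σO j σ₁ θ hfixO hιinj hσ₁j hσ₁θ hcoord hj' hθ'
  have hS₀' := coe_comap_prodOrder_eq ιO σO j σ₁ θ hσι hfixO hσ₁j hσ₁θ hcoord hϖF hϖ hιϖ hj' hθ' N S hS
  rw [hrange, hcomap, index_units_prodOrder_eq_pow ((j.comp ιO).codRestrict (RingHom.eqLocus σ₁ (RingHom.id O₁)) hj') ⟨θ, hθ'⟩ hθ'' haF hk₀ hcoord' hϖF N S₀ hS₀']
    at hidx
  exact hidx.symm

/-! ## §3 The boundary unit index `[C_{G₀} : G₀^×] = q^N` (SIG-F3-3 §0 (UG-bdry)) -/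

/-- **THE UNIT INDEX OF THE PRODUCT OVER-ORDER (glue depth `b = 0`): `[C_{G₀} : G₀^×] = q^N`.**  `Λ = 𝒪_E × O₁` (`O₁ = j𝒪_E ⊕ j𝒪_Eθ`, `θ² = j(ιO a)θ + j(ιO k₀)`,
`a, k₀ ∈ 𝔪_F`), `⋆ = (σO, σ₁)`, the norm `N(c) = c·c⋆` on `Λ^×` (onto the fixed units: `hnormE`, `hnorm₁`), `q_E = q²` (`hq`); for the product order `G₀ = G₀(N) = 𝒪_E × O_N`
(ANY subring `S` with `↑S = {z | ∃ b₀ c₀, z.2 = j b₀ + j c₀ Π_N}`, `Π_N = j(ϖ^N)θ`; ★ F3-1a `exists_subring_coe_eq_glued N 0 c′` + §0) and `C_{G₀} := N⁻¹(G₀^×)`: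
**`[C_{G₀} : G₀^×] = q^N`** (`q = #𝓀_F`) — ★ `relIndex_comap_norm_mul_relIndex_eq_index` (`G₀⋆ = G₀`) with `[Λ^× : G₀^×] = q_E^N = q^{2N}` (§1 over `E`) and
`[(Λ^⋆)^× : G₀^× ∩ (Λ^⋆)^×] = q^N` (§2).  In ★ (UG-idx) `exists_generator_relIndex_units_comap_norm_glued_eq`'s letters token for token, binders a SUBSET of its (no `hξ`, no
`hnormEb`, no level datum), every `N : ℕ`.  This is the boundary clause (UG-bdry) of SIG-F3-3 §0 = SIG-F3-5 (S6) `b = 0`: Rogawski's `q^N` at the product orders, for all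
rows (tame and wild: only the Eisenstein shape is used).
[cite: Rogawski1990, §4.9 Lemma 4.9.3 p. 56, Prop. 4.9.1 (b) p. 55] [cite: Neukirch1999, Ch. I §12] [cite: SerreLocalFields1979, Ch. V §2 Prop. 3] [cite: Jacobowitz1962, §7] -/
theorem relIndex_units_comap_norm_prodOrder_eq_pow [Finite 𝓀[F]] [Finite 𝓀[E]] (hσσ : ∀ x, σO (σO x) = x)
    (hσι : ∀ y, σO (ιO y) = ιO y) (hfixO : ∀ x, σO x = x → ∃ y, ιO y = x) (hιinj : Function.Injective ιO) (hιu : ∀ y, IsUnit (ιO y) → IsUnit y)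
    (hσ₁j : ∀ x, σ₁ (j x) = j (σO x)) (hσ₁θ : σ₁ θ = θ)
    (hθ : θ ^ 2 = j (ιO aF) * θ + j (ιO k₀F)) (haF : aF ∈ IsLocalRing.maximalIdeal 𝒪[F]) (hk₀ : k₀F ∈ IsLocalRing.maximalIdeal 𝒪[F])
    (hcoord : ∀ z : O₁, ∃! bc : 𝒪[E] × 𝒪[E], z = j bc.1 + j bc.2 * θ)
    (hnormE : ∀ b : 𝒪[E], IsUnit b → σO b = b → ∃ c : 𝒪[E], c * σO c = b) (hnorm₁ : ∀ z : O₁, IsUnit z → σ₁ z = z → ∃ w : O₁, w * σ₁ w = z)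
    {ϖF : F} {ϖ : E} (hϖF : IsUniformizingElement ϖF) (hϖ : IsUniformizingElement ϖ) (hιϖ : ιO ⟨ϖF, hϖF.mem⟩ = ⟨ϖ, hϖ.mem⟩)
    (hq : Nat.card 𝓀[E] = Nat.card 𝓀[F] ^ 2) (N : ℕ) (S : Subring (𝒪[E] × O₁))
    (hS : (S : Set (𝒪[E] × O₁)) = {z : 𝒪[E] × O₁ | ∃ b₀ c₀ : 𝒪[E], z.2 = j b₀ + j c₀ * (j ((⟨ϖ, hϖ.mem⟩ : 𝒪[E]) ^ N) * θ)}) :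
    (Units.map (S.subtype : S →* 𝒪[E] × O₁)).range.relIndex
      ((Units.map (S.subtype : S →* 𝒪[E] × O₁)).range.comap
        (MonoidHom.id (𝒪[E] × O₁)ˣ * Units.map (RingHom.prodMap σO σ₁ : 𝒪[E] × O₁ →* 𝒪[E] × O₁))) = Nat.card 𝓀[F] ^ N := by
  set π : 𝒪[E] := ⟨ϖ, hϖ.mem⟩ with hπ
  set V := (Units.map (S.subtype : S →* 𝒪[E] × O₁)).range with hV
  set Nm := MonoidHom.id (𝒪[E] × O₁)ˣ * Units.map (RingHom.prodMap σO σ₁ : 𝒪[E] × O₁ →* 𝒪[E] × O₁) with hNm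
  have ha : ιO aF ∈ IsLocalRing.maximalIdeal 𝒪[E] := map_k₀_mem_maximalIdeal ιO hιu haF
  have hk : ιO k₀F ∈ IsLocalRing.maximalIdeal 𝒪[E] := map_k₀_mem_maximalIdeal ιO hιu hk₀
  have hq1 : 1 < Nat.card 𝓀[F] := Finite.one_lt_card
  have hσπ : σO (π ^ N) = π ^ N := by rw [← hιϖ, ← map_pow, hσι]
  -- `G₀⋆ = G₀`
  have hmemS : ∀ z : 𝒪[E] × O₁, z ∈ S ↔ ∃ b₀ c₀ : 𝒪[E], z.2 = j b₀ + j c₀ * (j (π ^ N) * θ) := fun z => by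
    rw [← SetLike.mem_coe, hS, Set.mem_setOf_eq]
  have hstarS : ∀ z ∈ S, RingHom.prodMap σO σ₁ z ∈ S := by
    intro z hz
    obtain ⟨b₀, c₀, hbc⟩ := (hmemS z).1 hz
    refine (hmemS _).2 ⟨σO b₀, σO c₀, ?_⟩
    change σ₁ z.2 = _
    rw [hbc, map_add, map_mul, map_mul, hσ₁j, hσ₁j, hσ₁j, hσ₁θ, hσπ]
  -- `N(V) ⊆ V`
  have hNval : ∀ v : (𝒪[E] × O₁)ˣ, ((Nm v : (𝒪[E] × O₁)ˣ) : 𝒪[E] × O₁) = (v : 𝒪[E] × O₁) * RingHom.prodMap σO σ₁ v := fun v => by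
    rw [hNm, MonoidHom.mul_apply, Units.val_mul, MonoidHom.id_apply, Units.coe_map]; rfl
  have hVN : V ≤ V.comap Nm := by
    intro v hv
    rw [Subgroup.mem_comap, hV, mem_range_units_map_subtype_iff, ← map_inv, hNval, hNval]
    rw [hV, mem_range_units_map_subtype_iff] at hv
    exact ⟨S.mul_mem hv.1 (hstarS _ hv.1), S.mul_mem hv.2 (hstarS _ hv.2)⟩
  have key := relIndex_comap_norm_mul_relIndex_eq_index (RingHom.prodMap σO σ₁) V hVN
  rw [range_norm_eq σO j σ₁ θ hσσ hσ₁j hσ₁θ hcoord hnormE hnorm₁,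
    relIndex_units_fixed_prodOrder_eq_pow ιO σO j σ₁ θ hσι hfixO hιinj hσ₁j hσ₁θ hθ haF hk₀ hcoord hϖF hϖ hιϖ N S hS, hV,
    index_units_prodOrder_eq_pow j θ hθ ha hk hcoord hϖ N S hS, hq, ← pow_mul] at key
  -- arithmetic: `X · q^N = q^{2N}`
  have hpow : Nat.card 𝓀[F] ^ (2 * N) = Nat.card 𝓀[F] ^ N * Nat.card 𝓀[F] ^ N := by rw [two_mul, pow_add]
  rw [hpow] at key
  exact Nat.eq_of_mul_eq_mul_right (pow_pos (by omega) N) key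

end TwoFields

end Literature.NumberTheory.Automorphic

end
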